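import Summits.AtomisticToContinuum.HydrodynamicLimit.Theses.OneFlightGossipEngine
import Literature.MathematicalPhysics.KineticTheory.HardSphereEulerProofs
import Literature.Analysis.FluidPDE.HardSphereFlowJointMeasurable
import Summits.AtomisticToContinuum.HydrodynamicLimit.Theorems.OneFlightGossipEngineKineticCurrentsWindowLDUniformJensenTimeSum
import Summits.AtomisticToContinuum.HydrodynamicLimit.Theorems.OneFlightGossipEngineKineticCurrentsWindowLDUniformFibreExpMoment
import Summits.AtomisticToContinuum.HydrodynamicLimit.Theorems.OneFlightGossipEngineKineticCurrentsWindowLDUniformPathwiseWindow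
import Summits.AtomisticToContinuum.HydrodynamicLimit.Theorems.OneFlightGossipEngineKineticCurrentsWindowLDUniformWindowTransferOfRenyi
import Summits.AtomisticToContinuum.HydrodynamicLimit.Theorems.OneFlightGossipEngineKineticCurrentsWindowLDUniformAssembly
import Summits.AtomisticToContinuum.HydrodynamicLimit.Theorems.OneFlightGossipEngineKineticCurrentsWindowLDUniformClassTruncation

/-!
# Skeleton — crux `KineticCurrentsWindowLDUniform` (stmt-AtomisticToContinuum-14662), line `Sketch`

Lead skeleton for the picked line `Sketch` (ideator 2; spine = card `quasi-invariance-cocycle`: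
"local Gibbs is `e^{o(N)}`-quasi-invariant over kinetic windows, Jensen in time makes the quadratic
velocity tails static, so the crux is equivalent to its bounded-class sub-crux").

Composition (`KineticCurrentsWindowLDUniform_of`), for an admissible `F = A(x):w⊗w + (b·w)G(x,|w|²)`:

1. `stub_classTruncation` (static, provable): `F = F' + R`, `F'` a BOUNDED, continuous, still-orthogonal
   member of the radially weighted class `H'(x,|w|²)·A:(w⊗w) + (b·w)G'(x,|w|²)` with quadratic-growth
   constant `C₁` INDEPENDENT of the truncation level, `|R| ≤ Y`, `Y ≥ 0` continuous with local-Maxwellian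
   exponential moment `∫ e^{κ₀ Y(x,·)} M_x ≤ e^{η}` at every `x`, for any prescribed `η > 0`.
2. `stub_pathwiseWindow` (provable): on the good set every continuous one-body observable is interval
   integrable along the flow, so window sums are linear in `F` and `|S(R)| ≤ S(Y)` pathwise.
3. Hölder (`p = p* = 2`) in `ℝ≥0∞`: `∫ e^{βS(F)} ≤ (∫ e^{2βS(F')})^{1/2} (∫ e^{2|β|S(Y)})^{1/2}`.
4. `stub_boundedClassWindowLD` (C⁺, the line's dynamical residual — the crux for bounded members of the
   widened class with `β₀` depending on the functional only through its growth constant) bounds the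
   first factor.
5. `stub_jensenTimeSum` (provable): the second factor is at most the worst single-time exponential
   moment `sup_{r ≤ w_N} ∫ e^{2|β| Σᵢ Y(Φ_r z i)} dλ`.
6. `stub_windowTransfer` (Rényi quasi-invariance of the local Gibbs law over a kinetic window; `q = 1`,
   `δ = 0` at constant profiles by invariance): moves the time-`r` moment back to time `0` at cost
   `e^{δ(N+1)}` and exponent `q`.
7. `stub_fibreExpMoment` (static, provable): given the positions the velocities are independent
   Gaussians, so `∫ e^{κ Σᵢ Y(zᵢ)} dλ ≤ (sup_x ∫ e^{κ Y(x,·)} M_x)^{N+1} ≤ e^{η(N+1)}`.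
8. `stub_assembly`: the arithmetic `∃β₀ ∀β ∀ε ∃τ ∃N₀` bookkeeping (`β₀ := min(β₀'/2, κ₀/(2q))`,
   `ε' = ε`, `δ = η = ε/2`).

STATUS (cycle 1, 2026-08-16): S1 LANDED p86471 · S2 LANDED p86164 · S3 LANDED p91214 (+ helpers p89150, p91147) ·
S4 LANDED p86158 · S5 DERIVED from S5' via the landed glue p89950 (S5' = `stub_windowRenyi`, research-level off
isothermal; isothermal instance of S5 landed separately as `stub_windowTransfer_isothermal`, constant-profile
instance `stub_windowTransfer_const`) · S6 OPEN (the line's residual C⁺) · S7 LANDED p88778. Remaining sorries: S5', S6.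

Disproof.lean (cycle 1) honoured: §1 (`N₀` load-bearing) — collisions enter only through C⁺, false at
`N = 0` as it must be; §3 (`β₀` static) — `β` is multiplied only by the fixed exponents `2` and `q`, never
by a `τ`-dependent factor; §4 (`⊥ v_j` load-bearing) — the truncation keeps all three orthogonality
clauses and C⁺ demands them; §2 — `⊥‖v‖²` is NOT redundant in the widened class (radial weight), kept.
-/

noncomputable section

open MeasureTheory Set Filter
open scoped ENNReal Topology

namespace Summit.AtomisticToContinuum.HydrodynamicLimit.Cruxes.KineticCurrentsWindowLDUniform.Lines.Sketch

open Literature.Analysis.FluidPDE (HardSphereFlow Config localMaxwellian canonicalDensity liouville)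
open Literature.MathematicalPhysics.KineticTheory (T3 V3 hsDiameter localGibbsLaw localGibbsMeasure
  localGibbsProfile)
open Summit.AtomisticToContinuum.HydrodynamicLimit.Theses.OneFlightGossipEngine
  (KineticCurrentsWindowLDUniform)

/-! ## Stubs (signatures fully expanded over tree vocabulary: the registry matches `--supports` files by name + signature text) -/

/-- S1 — JENSEN IN TIME FOR WINDOW SUMS OF NON-NEGATIVE FUNCTIONALS. For maps `T : ℝ → Ω → Ω` jointly
measurable on `S × ℝ` (`μ(Sᶜ) = 0`), measurable `Y_i ≥ 0` and a window `w > 0`: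
`∫⁻ exp(Σᵢ w⁻¹∫₀ʷ Yᵢ(T_r ω) dr) dμ ≤ sup_{r ∈ [0,w]} ∫⁻ exp(Σᵢ Yᵢ(T_r ω)) dμ`
(junk-safe: a non-integrable `r ↦ Yᵢ(T_r ω)` contributes `0` on the left). -/
theorem stub_jensenTimeSum :
    ∀ (Ω : Type) [MeasurableSpace Ω] (μ : Measure Ω) (S : Set Ω), MeasurableSet S → μ Sᶜ = 0 →
      ∀ (T : ℝ → Ω → Ω), Measurable (fun p : S × ℝ => T p.2 (p.1 : Ω)) →
      ∀ (n : ℕ) (Y : Fin n → Ω → ℝ), (∀ i, Measurable (Y i)) → (∀ i ω, 0 ≤ Y i ω) →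
      ∀ w : ℝ, 0 < w →
        ∫⁻ ω, ENNReal.ofReal (Real.exp (∑ i, w⁻¹ * ∫ r in (0 : ℝ)..w, Y i (T r ω))) ∂μ ≤
          ⨆ r ∈ Set.Icc (0 : ℝ) w, ∫⁻ ω, ENNReal.ofReal (Real.exp (∑ i, Y i (T r ω))) ∂μ :=
  Summit.AtomisticToContinuum.HydrodynamicLimit.Theorems.KineticCurrentsWindowLDUniformSketch.stub_jensenTimeSum

/-- S2 — STATIC FIBRE EXPONENTIAL MOMENTS UNDER THE LOCAL GIBBS MEASURE. Given the positions the
velocities are independent Gaussians `N(u₀(xᵢ), θ₀(xᵢ))`, so a product of one-body non-negative factors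
integrates to at most the `(N+1)`-st power of the worst fibre integral. -/
theorem stub_fibreExpMoment :
    ∀ (a θ₀ : T3 → ℝ) (u₀ : T3 → V3), Continuous a → Continuous θ₀ → Continuous u₀ →
      (∀ x, 0 < a x) → (∀ x, 0 < θ₀ x) → ∀ σ : ℝ, 0 < σ → σ ≤ 1 / 2 → ∀ N : ℕ,
      ∀ g : T3 × V3 → ℝ≥0∞, Measurable g → ∀ K : ℝ≥0∞,
      (∀ x : T3, ∫⁻ v, g (x, v) * ENNReal.ofReal (localMaxwellian 1 (θ₀ x) (u₀ x) v) ≤ K) →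
        ∫⁻ z, ∏ i, g (z i) ∂(localGibbsMeasure σ a u₀ θ₀ N) ≤ K ^ (N + 1) :=
  Summit.AtomisticToContinuum.HydrodynamicLimit.Theorems.KineticCurrentsWindowLDUniformSketch.stub_fibreExpMoment

/-- S3 — TRUNCATION OF THE CLASS WITH RADIAL RE-ORTHOGONALISATION (static). An admissible crux
functional `F = A(x):(w⊗w) + (b·w)G(x,|w|²)` (`w = v − u₀(x)`; growth `C`; `⊥ 1, v_j, ‖v‖²` under
`M_{1,u₀(x),θ₀(x)}` at every `x`) splits, for every `η > 0`, as `F = F' + R` with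
`F' = H'(x,|w|²)·A:(w⊗w) + (b·w)G'(x,|w|²)` continuous, BOUNDED, of growth `≤ C₁(1+‖v‖²)` with `C₁`
independent of `η`, still orthogonal, and `|R| ≤ Y`, `Y ≥ 0` continuous with
`∫ e^{κ₀ Y(x,v)} M_x(v) dv ≤ e^{η}` at every `x` (`κ₀ > 0` independent of `η`). -/
theorem stub_classTruncation :
    ∀ (θ₀ : T3 → ℝ) (u₀ : T3 → V3), Continuous θ₀ → Continuous u₀ → (∀ x, 0 < θ₀ x) →
      ∀ (A : T3 → Fin 3 → Fin 3 → ℝ) (b : T3 → V3) (G : T3 × ℝ → ℝ),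
      Continuous A → Continuous b → Continuous G →
      ∀ (F : T3 × V3 → ℝ), (∀ y, F y =
        (∑ j : Fin 3, ∑ k : Fin 3, A y.1 j k * ((y.2 - u₀ y.1) j * (y.2 - u₀ y.1) k)) +
          (∑ j : Fin 3, b y.1 j * (y.2 - u₀ y.1) j) * G (y.1, ‖y.2 - u₀ y.1‖ ^ 2)) →
      ∀ C : ℝ, (∀ y, |F y| ≤ C * (1 + ‖y.2‖ ^ 2)) →
      (∀ x, ∫ v, F (x, v) * localMaxwellian 1 (θ₀ x) (u₀ x) v = 0) →
      (∀ x (j : Fin 3), ∫ v, F (x, v) * v j * localMaxwellian 1 (θ₀ x) (u₀ x) v = 0) →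
      (∀ x, ∫ v, F (x, v) * ‖v‖ ^ 2 * localMaxwellian 1 (θ₀ x) (u₀ x) v = 0) →
      ∃ C₁ : ℝ, 0 ≤ C₁ ∧ ∃ κ₀ : ℝ, 0 < κ₀ ∧ ∀ η : ℝ, 0 < η →
        ∃ (H' G' : T3 × ℝ → ℝ), Continuous H' ∧ Continuous G' ∧
        ∃ (F' Y : T3 × V3 → ℝ), (∀ y, F' y =
          H' (y.1, ‖y.2 - u₀ y.1‖ ^ 2) *
              (∑ j : Fin 3, ∑ k : Fin 3, A y.1 j k * ((y.2 - u₀ y.1) j * (y.2 - u₀ y.1) k)) +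
            (∑ j : Fin 3, b y.1 j * (y.2 - u₀ y.1) j) * G' (y.1, ‖y.2 - u₀ y.1‖ ^ 2)) ∧
          Continuous Y ∧ (∀ y, 0 ≤ Y y) ∧
          (∃ B : ℝ, ∀ y, |F' y| ≤ B) ∧
          (∀ y, |F' y| ≤ C₁ * (1 + ‖y.2‖ ^ 2)) ∧
          (∀ x, ∫ v, F' (x, v) * localMaxwellian 1 (θ₀ x) (u₀ x) v = 0) ∧
          (∀ x (j : Fin 3), ∫ v, F' (x, v) * v j * localMaxwellian 1 (θ₀ x) (u₀ x) v = 0) ∧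
          (∀ x, ∫ v, F' (x, v) * ‖v‖ ^ 2 * localMaxwellian 1 (θ₀ x) (u₀ x) v = 0) ∧
          (∀ y, |F y - F' y| ≤ Y y) ∧
          (∀ x, ∫⁻ v, ENNReal.ofReal (Real.exp (κ₀ * Y (x, v)) * localMaxwellian 1 (θ₀ x) (u₀ x) v)
            ≤ ENNReal.ofReal (Real.exp η)) :=
  Summit.AtomisticToContinuum.HydrodynamicLimit.Theorems.KineticCurrentsWindowLDUniformSketch.stub_classTruncation

/-- S4 — PATHWISE WINDOW INTEGRABILITY. On the good set of a hard-sphere flow on `𝕋³`, every continuous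
one-body observable is interval integrable in time along every particle's trajectory (measurable
right-continuous trajectory, bounded velocities by energy conservation, compact position space). -/
theorem stub_pathwiseWindow :
    ∀ (σ : ℝ) (N : ℕ)
      (Φ : HardSphereFlow (Literature.Analysis.FluidPDE.Torus.geometry (Fin 3)) (hsDiameter σ N) (N + 1)),
      ∀ z ∈ Φ.good, ∀ (f : T3 × V3 → ℝ), Continuous f → ∀ (i : Fin (N + 1)) (a b : ℝ),
        IntervalIntegrable (fun r => f ((Φ.flow r z) i)) volume a b :=
  Summit.AtomisticToContinuum.HydrodynamicLimit.Theorems.KineticCurrentsWindowLDUniformSketch.stub_pathwiseWindow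

/-- S5' — RÉNYI QUASI-INVARIANCE OF THE LOCAL GIBBS LAW OVER A KINETIC WINDOW (the exact dynamical residual
of S5, registered `stub_windowRenyi`; research-level off isothermal profiles — the isothermal case of S5 is
landed separately as `stub_windowTransfer_isothermal`). For continuous positive profiles and `σ ≤ 1/2` there is
an order `p > 1` such that for every window parameter `τ`, every `δ > 0`, every flow family and all large `N`,
uniformly in `r ∈ [0, τ(N+1)^{-1/3}]`: `∫ (ψ∘Φ_{-r})^p ψ^{1-p} dL ≤ e^{pδ(N+1)}` (`ψ` the canonical local Gibbs
density, `L` the Liouville measure). -/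
theorem stub_windowRenyi :
    ∀ (a θ₀ : T3 → ℝ) (u₀ : T3 → V3), Continuous a → Continuous θ₀ → Continuous u₀ →
    (∀ x, 0 < a x) → (∀ x, 0 < θ₀ x) → ∀ σ : ℝ, 0 < σ → σ ≤ 1 / 2 →
    ∃ p : ℝ, 1 < p ∧ ∀ τ : ℝ, 0 < τ → ∀ δ : ℝ, 0 < δ →
    ∀ Φ : (N : ℕ) →
      HardSphereFlow (Literature.Analysis.FluidPDE.Torus.geometry (Fin 3)) (hsDiameter σ N) (N + 1),
    ∃ N₀ : ℕ, ∀ N : ℕ, N₀ ≤ N → ∀ r ∈ Set.Icc (0 : ℝ) (τ * ((N : ℝ) + 1) ^ (-(1 / 3 : ℝ))),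
      ∫⁻ z, ENNReal.ofReal (canonicalDensity (Literature.Analysis.FluidPDE.Torus.geometry (Fin 3))
            (hsDiameter σ N) (N + 1) (localGibbsProfile a u₀ θ₀) ((Φ N).flow (-r) z)) ^ p *
          ENNReal.ofReal (canonicalDensity (Literature.Analysis.FluidPDE.Torus.geometry (Fin 3))
            (hsDiameter σ N) (N + 1) (localGibbsProfile a u₀ θ₀) z) ^ (1 - p)
        ∂(liouville (Literature.Analysis.FluidPDE.Torus.geometry (Fin 3)) (N + 1) (hsDiameter σ N)) ≤
      ENNReal.ofReal (Real.exp (p * (δ * ((N : ℝ) + 1)))) := by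
  sorry

/-- S5 — WINDOW TRANSFER (Rényi quasi-invariance of the local Gibbs law over a kinetic window). For
continuous positive profiles and `σ ≤ 1/2` there is an exponent `q ≥ 1` such that for every macroscopic
window parameter `τ`, every `δ > 0`, every flow family and all large `N`: single-time expectations of
non-negative functionals at any time `r ∈ [0, τ(N+1)^{-1/3}]` are bounded by `e^{δ(N+1)}` times the
`L^q(λ^N)`-norm at time `0`. (Constant profiles: `q = 1`, `δ = 0`, equality — invariance. General
profiles: Liouville transport of the density + Hölder + a Rényi-divergence bound of order `q/(q-1)`.) -/
theorem stub_windowTransfer :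
    ∀ (a θ₀ : T3 → ℝ) (u₀ : T3 → V3), Continuous a → Continuous θ₀ → Continuous u₀ →
      (∀ x, 0 < a x) → (∀ x, 0 < θ₀ x) → ∀ σ : ℝ, 0 < σ → σ ≤ 1 / 2 →
      ∃ q : ℝ, 1 ≤ q ∧ ∀ τ : ℝ, 0 < τ → ∀ δ : ℝ, 0 < δ →
      ∀ Φ : (N : ℕ) →
        HardSphereFlow (Literature.Analysis.FluidPDE.Torus.geometry (Fin 3)) (hsDiameter σ N) (N + 1),
      ∃ N₀ : ℕ, ∀ N : ℕ, N₀ ≤ N → ∀ r ∈ Set.Icc (0 : ℝ) (τ * ((N : ℝ) + 1) ^ (-(1 / 3 : ℝ))),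
      ∀ G : Config (N + 1) (Fin 3) T3 → ℝ≥0∞, Measurable G →
        ∫⁻ z, G ((Φ N).flow r z) ∂(localGibbsLaw σ a u₀ θ₀ N (Φ N)) ≤
          ENNReal.ofReal (Real.exp (δ * ((N : ℝ) + 1))) *
            (∫⁻ z, G z ^ q ∂(localGibbsLaw σ a u₀ θ₀ N (Φ N))) ^ (1 / q) :=
  Summit.AtomisticToContinuum.HydrodynamicLimit.Theorems.KineticCurrentsWindowLDUniformSketch.stub_windowTransfer_of_renyi
    stub_windowRenyi

/-- S6 — THE LINE'S DYNAMICAL RESIDUAL `C⁺`: WINDOW LD FOR BOUNDED MEMBERS OF THE (RADIALLY WEIGHTED)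
CLASS, `β₀` UNIFORM GIVEN THE GROWTH CONSTANT. The crux verbatim except: the class is widened by a
continuous radial weight `H(x,|w|²)` on the stress part; the functional is moreover BOUNDED; and `β₀` is
chosen after the growth constant `C` but BEFORE the functional (it may not depend on the sup-bound `B`,
only `τ, N₀` may). Collisions enter the line here and only here (false at `N = 0`, Disproof §1). -/
theorem stub_boundedClassWindowLD :
    ∃ η₀ : ℝ, 0 < η₀ ∧ ∀ (a θ₀ : T3 → ℝ) (u₀ : T3 → V3), Continuous a → Continuous θ₀ → Continuous u₀ →
      (∀ x, 0 < a x) → (∀ x, 0 < θ₀ x) → ∀ σ : ℝ, 0 < σ → σ ^ 3 * (⨆ x, a x) ≤ η₀ * ∫ x, a x →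
      ∀ Φ : (N : ℕ) →
        HardSphereFlow (Literature.Analysis.FluidPDE.Torus.geometry (Fin 3)) (hsDiameter σ N) (N + 1),
      ∀ C : ℝ, 0 ≤ C → ∃ β₀ : ℝ, 0 < β₀ ∧
      ∀ (A : T3 → Fin 3 → Fin 3 → ℝ) (H : T3 × ℝ → ℝ) (b : T3 → V3) (G : T3 × ℝ → ℝ),
      Continuous A → Continuous H → Continuous b → Continuous G →
      ∀ (F : T3 × V3 → ℝ), (∀ y, F y =
        H (y.1, ‖y.2 - u₀ y.1‖ ^ 2) *
            (∑ j : Fin 3, ∑ k : Fin 3, A y.1 j k * ((y.2 - u₀ y.1) j * (y.2 - u₀ y.1) k)) +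
          (∑ j : Fin 3, b y.1 j * (y.2 - u₀ y.1) j) * G (y.1, ‖y.2 - u₀ y.1‖ ^ 2)) →
      (∃ B : ℝ, ∀ y, |F y| ≤ B) → (∀ y, |F y| ≤ C * (1 + ‖y.2‖ ^ 2)) →
      (∀ x, ∫ v, F (x, v) * localMaxwellian 1 (θ₀ x) (u₀ x) v = 0) →
      (∀ x (j : Fin 3), ∫ v, F (x, v) * v j * localMaxwellian 1 (θ₀ x) (u₀ x) v = 0) →
      (∀ x, ∫ v, F (x, v) * ‖v‖ ^ 2 * localMaxwellian 1 (θ₀ x) (u₀ x) v = 0) →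
      ∀ β : ℝ, |β| ≤ β₀ → ∀ ε : ℝ, 0 < ε → ∃ τ : ℝ, 0 < τ ∧ ∃ N₀ : ℕ, ∀ N : ℕ, N₀ ≤ N →
        ∫⁻ z, ENNReal.ofReal (Real.exp (β * ∑ i : Fin (N + 1),
          (τ * ((N : ℝ) + 1) ^ (-(1 / 3 : ℝ)))⁻¹ *
            ∫ r in (0 : ℝ)..(τ * ((N : ℝ) + 1) ^ (-(1 / 3 : ℝ))), F (((Φ N).flow r z) i)))
          ∂(localGibbsLaw σ a u₀ θ₀ N (Φ N)) ≤ ENNReal.ofReal (Real.exp (ε * ((N : ℝ) + 1))) := by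
  sorry

/-- S7 — ASSEMBLY, LANDED (p88778, `Theorems/OneFlightGossipEngineKineticCurrentsWindowLDUniformAssembly.lean`, lead): Hölder + push-forward + quantifier bookkeeping; hypotheses are S1–S6 verbatim. -/
theorem stub_assembly :
    (∀ (Ω : Type) [MeasurableSpace Ω] (μ : Measure Ω) (S : Set Ω), MeasurableSet S → μ Sᶜ = 0 →
        ∀ (T : ℝ → Ω → Ω), Measurable (fun p : S × ℝ => T p.2 (p.1 : Ω)) →
        ∀ (n : ℕ) (Y : Fin n → Ω → ℝ), (∀ i, Measurable (Y i)) → (∀ i ω, 0 ≤ Y i ω) →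
        ∀ w : ℝ, 0 < w →
          ∫⁻ ω, ENNReal.ofReal (Real.exp (∑ i, w⁻¹ * ∫ r in (0 : ℝ)..w, Y i (T r ω))) ∂μ ≤
            ⨆ r ∈ Set.Icc (0 : ℝ) w, ∫⁻ ω, ENNReal.ofReal (Real.exp (∑ i, Y i (T r ω))) ∂μ) →
    (∀ (a θ₀ : T3 → ℝ) (u₀ : T3 → V3), Continuous a → Continuous θ₀ → Continuous u₀ →
        (∀ x, 0 < a x) → (∀ x, 0 < θ₀ x) → ∀ σ : ℝ, 0 < σ → σ ≤ 1 / 2 → ∀ N : ℕ,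
        ∀ g : T3 × V3 → ℝ≥0∞, Measurable g → ∀ K : ℝ≥0∞,
        (∀ x : T3, ∫⁻ v, g (x, v) * ENNReal.ofReal (localMaxwellian 1 (θ₀ x) (u₀ x) v) ≤ K) →
          ∫⁻ z, ∏ i, g (z i) ∂(localGibbsMeasure σ a u₀ θ₀ N) ≤ K ^ (N + 1)) →
    (∀ (θ₀ : T3 → ℝ) (u₀ : T3 → V3), Continuous θ₀ → Continuous u₀ → (∀ x, 0 < θ₀ x) →
        ∀ (A : T3 → Fin 3 → Fin 3 → ℝ) (b : T3 → V3) (G : T3 × ℝ → ℝ),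
        Continuous A → Continuous b → Continuous G →
        ∀ (F : T3 × V3 → ℝ), (∀ y, F y =
          (∑ j : Fin 3, ∑ k : Fin 3, A y.1 j k * ((y.2 - u₀ y.1) j * (y.2 - u₀ y.1) k)) +
            (∑ j : Fin 3, b y.1 j * (y.2 - u₀ y.1) j) * G (y.1, ‖y.2 - u₀ y.1‖ ^ 2)) →
        ∀ C : ℝ, (∀ y, |F y| ≤ C * (1 + ‖y.2‖ ^ 2)) →
        (∀ x, ∫ v, F (x, v) * localMaxwellian 1 (θ₀ x) (u₀ x) v = 0) →
        (∀ x (j : Fin 3), ∫ v, F (x, v) * v j * localMaxwellian 1 (θ₀ x) (u₀ x) v = 0) →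
        (∀ x, ∫ v, F (x, v) * ‖v‖ ^ 2 * localMaxwellian 1 (θ₀ x) (u₀ x) v = 0) →
        ∃ C₁ : ℝ, 0 ≤ C₁ ∧ ∃ κ₀ : ℝ, 0 < κ₀ ∧ ∀ η : ℝ, 0 < η →
          ∃ (H' G' : T3 × ℝ → ℝ), Continuous H' ∧ Continuous G' ∧
          ∃ (F' Y : T3 × V3 → ℝ), (∀ y, F' y =
            H' (y.1, ‖y.2 - u₀ y.1‖ ^ 2) *
                (∑ j : Fin 3, ∑ k : Fin 3, A y.1 j k * ((y.2 - u₀ y.1) j * (y.2 - u₀ y.1) k)) +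
              (∑ j : Fin 3, b y.1 j * (y.2 - u₀ y.1) j) * G' (y.1, ‖y.2 - u₀ y.1‖ ^ 2)) ∧
            Continuous Y ∧ (∀ y, 0 ≤ Y y) ∧
            (∃ B : ℝ, ∀ y, |F' y| ≤ B) ∧
            (∀ y, |F' y| ≤ C₁ * (1 + ‖y.2‖ ^ 2)) ∧
            (∀ x, ∫ v, F' (x, v) * localMaxwellian 1 (θ₀ x) (u₀ x) v = 0) ∧
            (∀ x (j : Fin 3), ∫ v, F' (x, v) * v j * localMaxwellian 1 (θ₀ x) (u₀ x) v = 0) ∧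
            (∀ x, ∫ v, F' (x, v) * ‖v‖ ^ 2 * localMaxwellian 1 (θ₀ x) (u₀ x) v = 0) ∧
            (∀ y, |F y - F' y| ≤ Y y) ∧
            (∀ x, ∫⁻ v, ENNReal.ofReal (Real.exp (κ₀ * Y (x, v)) * localMaxwellian 1 (θ₀ x) (u₀ x) v)
              ≤ ENNReal.ofReal (Real.exp η))) →
    (∀ (σ : ℝ) (N : ℕ)
        (Φ : HardSphereFlow (Literature.Analysis.FluidPDE.Torus.geometry (Fin 3)) (hsDiameter σ N) (N + 1)),
        ∀ z ∈ Φ.good, ∀ (f : T3 × V3 → ℝ), Continuous f → ∀ (i : Fin (N + 1)) (a b : ℝ),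
          IntervalIntegrable (fun r => f ((Φ.flow r z) i)) volume a b) →
    (∀ (a θ₀ : T3 → ℝ) (u₀ : T3 → V3), Continuous a → Continuous θ₀ → Continuous u₀ →
        (∀ x, 0 < a x) → (∀ x, 0 < θ₀ x) → ∀ σ : ℝ, 0 < σ → σ ≤ 1 / 2 →
        ∃ q : ℝ, 1 ≤ q ∧ ∀ τ : ℝ, 0 < τ → ∀ δ : ℝ, 0 < δ →
        ∀ Φ : (N : ℕ) →
          HardSphereFlow (Literature.Analysis.FluidPDE.Torus.geometry (Fin 3)) (hsDiameter σ N) (N + 1),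
        ∃ N₀ : ℕ, ∀ N : ℕ, N₀ ≤ N → ∀ r ∈ Set.Icc (0 : ℝ) (τ * ((N : ℝ) + 1) ^ (-(1 / 3 : ℝ))),
        ∀ G : Config (N + 1) (Fin 3) T3 → ℝ≥0∞, Measurable G →
          ∫⁻ z, G ((Φ N).flow r z) ∂(localGibbsLaw σ a u₀ θ₀ N (Φ N)) ≤
            ENNReal.ofReal (Real.exp (δ * ((N : ℝ) + 1))) *
              (∫⁻ z, G z ^ q ∂(localGibbsLaw σ a u₀ θ₀ N (Φ N))) ^ (1 / q)) →
    (∃ η₀ : ℝ, 0 < η₀ ∧ ∀ (a θ₀ : T3 → ℝ) (u₀ : T3 → V3), Continuous a → Continuous θ₀ → Continuous u₀ →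
        (∀ x, 0 < a x) → (∀ x, 0 < θ₀ x) → ∀ σ : ℝ, 0 < σ → σ ^ 3 * (⨆ x, a x) ≤ η₀ * ∫ x, a x →
        ∀ Φ : (N : ℕ) →
          HardSphereFlow (Literature.Analysis.FluidPDE.Torus.geometry (Fin 3)) (hsDiameter σ N) (N + 1),
        ∀ C : ℝ, 0 ≤ C → ∃ β₀ : ℝ, 0 < β₀ ∧
        ∀ (A : T3 → Fin 3 → Fin 3 → ℝ) (H : T3 × ℝ → ℝ) (b : T3 → V3) (G : T3 × ℝ → ℝ),
        Continuous A → Continuous H → Continuous b → Continuous G →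
        ∀ (F : T3 × V3 → ℝ), (∀ y, F y =
          H (y.1, ‖y.2 - u₀ y.1‖ ^ 2) *
              (∑ j : Fin 3, ∑ k : Fin 3, A y.1 j k * ((y.2 - u₀ y.1) j * (y.2 - u₀ y.1) k)) +
            (∑ j : Fin 3, b y.1 j * (y.2 - u₀ y.1) j) * G (y.1, ‖y.2 - u₀ y.1‖ ^ 2)) →
        (∃ B : ℝ, ∀ y, |F y| ≤ B) → (∀ y, |F y| ≤ C * (1 + ‖y.2‖ ^ 2)) →
        (∀ x, ∫ v, F (x, v) * localMaxwellian 1 (θ₀ x) (u₀ x) v = 0) →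
        (∀ x (j : Fin 3), ∫ v, F (x, v) * v j * localMaxwellian 1 (θ₀ x) (u₀ x) v = 0) →
        (∀ x, ∫ v, F (x, v) * ‖v‖ ^ 2 * localMaxwellian 1 (θ₀ x) (u₀ x) v = 0) →
        ∀ β : ℝ, |β| ≤ β₀ → ∀ ε : ℝ, 0 < ε → ∃ τ : ℝ, 0 < τ ∧ ∃ N₀ : ℕ, ∀ N : ℕ, N₀ ≤ N →
          ∫⁻ z, ENNReal.ofReal (Real.exp (β * ∑ i : Fin (N + 1),
            (τ * ((N : ℝ) + 1) ^ (-(1 / 3 : ℝ)))⁻¹ *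
              ∫ r in (0 : ℝ)..(τ * ((N : ℝ) + 1) ^ (-(1 / 3 : ℝ))), F (((Φ N).flow r z) i)))
            ∂(localGibbsLaw σ a u₀ θ₀ N (Φ N)) ≤ ENNReal.ofReal (Real.exp (ε * ((N : ℝ) + 1)))) →
    KineticCurrentsWindowLDUniform :=
  Summit.AtomisticToContinuum.HydrodynamicLimit.Theorems.KineticCurrentsWindowLDUniformSketch.stub_assembly

/-! ## Composition -/

/-- The line closes the crux modulo its stubs. -/
theorem KineticCurrentsWindowLDUniform_of : KineticCurrentsWindowLDUniform :=
  stub_assembly stub_jensenTimeSum stub_fibreExpMoment stub_classTruncation stub_pathwiseWindow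
    stub_windowTransfer stub_boundedClassWindowLD

end Summit.AtomisticToContinuum.HydrodynamicLimit.Cruxes.KineticCurrentsWindowLDUniform.Lines.Sketch
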